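import Mathlib
import Literature.LinearAlgebra.Matrix.MaximalVolumeSingularValueBound
import Literature.LinearAlgebra.Matrix.FrobeniusNormSingularValues

/-!
# Maximal-volume cross interpolation: the refined bound of Allen–Lai–Shen

[AllenLaiShen2024, §2 Thm 3]: if the `r × r` pivot block `A_{I,J}` of a real matrix `A` has maximal
volume, the cross (skeleton, CUR) interpolation `A_r = A_{:,J} A_{I,J}⁻¹ A_{I,:}` satisfies

  `‖A − A_r‖_C ≤ (r+1) σ_{r+1}(A) / √(1 + r σ²_{r+1}(A) / ((r+1) ‖A‖₂²))`,

sharpening the Goreinov–Tyrtyshnikov bound `(r+1) σ_{r+1}(A)`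
(`Literature.LinearAlgebra.Matrix.abs_sub_crossInterp_le_mul_singularValues_of_volume_maximal_fin`);
[AllenLaiShen2024, §2 Thm 4] is the version with a volume ratio `ν ∈ (0, 1]`
(`|det A_{I,J}| = ν |det A_♢|`, `A_♢` of maximal volume):
`‖A − A_r‖_C ≤ (r+1) σ_{r+1}(A) / (ν √(1 + r σ²_{r+1}(A) ν² / ((r+1) ‖A‖₂²)))`.

INDEXING.  As in `Literature.LinearAlgebra.Matrix.MaximalVolumeSingularValueBound`: `k` pivots
`r : Fin k → m`, `c : Fin k → n`, `Ã = crossInterp A r c`, singular values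
`(Matrix.toEuclideanLin A).singularValues` ZERO-INDEXED (`singularValues k` is the papers'
`σ_{k+1}(A)`, `singularValues 0 = σ₁(A) = ‖A‖₂`, `Literature.LinearAlgebra.Matrix.singularValues_zero_eq_opNorm`).

THE PROOF, and a slightly stronger inequality.  Fix an entry `γ = (A − Ã) i j ≠ 0` and let
`Â = A[(i, r), (j, c)]` be the bordered `(k+1) × (k+1)` block, `L = Â⁻¹`.  The ingredients of
[AllenLaiShen2024, §3 (proof of Thm 3)] are
* `‖L‖_C ≤ (ν |γ|)⁻¹` (`det Â = det P · γ` and the volume hypothesis;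
  `Literature.LinearAlgebra.Matrix.mul_abs_inv_submatrix_vecCons_vecCons_mul_abs_le_one`);
* `σ₁(L)² + k σ_{k+1}(L)² ≤ ‖L‖_F² ≤ (k+1)² ‖L‖_C²` (the Frobenius identity `‖L‖_F² = Σ σ_i(L)²`,
  `Literature.LinearAlgebra.Matrix.sq_singularValues_zero_add_mul_sq_singularValues_le_sum_sq_norm_entry`);
* `1 ≤ σ_{k+1}(Â) σ₁(L)` and `1 ≤ σ₁(Â) σ_{k+1}(L)` (`σ₁(L) = 1/σ_{k+1}(Â)`,
  `σ_{k+1}(L) = 1/σ₁(Â)`), proved here as `one_le_singularValues_card_sub_one_mul_singularValues_zero_inv`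
  and `one_le_singularValues_zero_mul_singularValues_card_sub_one_inv`;
* interlacing `σ_{k+1}(Â) ≤ σ_{k+1}(A)`, `σ₁(Â) ≤ σ₁(A)`
  (`Literature.LinearAlgebra.Matrix.singularValues_submatrix_le`).
Chaining them WITHOUT the normalisation `Σ_i σ_i(L)² ≤ (k+1) σ₁(L)²` used in the source gives, for
every entry,

  `ν² |(A − Ã) i j|² (σ₁(A)² + k σ_{k+1}(A)²) ≤ (k+1)² σ_{k+1}(A)² σ₁(A)²`

(`sq_mul_sq_sub_crossInterp_mul_le_of_volume_submaximal_fin`), i.e.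
`|(A − Ã) i j| ≤ (k+1) σ_{k+1}(A) / (ν √(1 + k σ²_{k+1}(A)/σ₁(A)²))`
(`abs_sub_crossInterp_le_div_sqrt_of_volume_submaximal_fin`), from which the printed bounds of
[AllenLaiShen2024, Thm 3, Thm 4] follow because their square roots are smaller
(`abs_sub_crossInterp_le_of_volume_maximal_fin_allenLaiShen`,
`abs_sub_crossInterp_le_of_volume_submaximal_fin_allenLaiShen`).  The dominance hypothesis of
[AllenLaiShen2024, Thm 4] is not needed for the inequality; only the volume ratio `ν` enters.

References: K. Allen, M.-J. Lai, Z. Shen, *Maximal volume matrix cross approximation for image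
compression and least squares solution*, Adv. Comput. Math. (2024), arXiv:2309.17403, §2 Thm 3,
Thm 4, §3; S. A. Goreinov, E. E. Tyrtyshnikov, *The maximal-volume concept in approximation by
low-rank matrices*, Contemp. Math. 280 (2001) 47–51, Thm 2.1, Thm 2.2.
AI-produced formalisation (H21 engines group, seat eng-quad-2, 2026-08-22); no facts, no axioms
beyond Mathlib's, no `sorry`.
-/

noncomputable section

open Matrix Module

namespace Literature.LinearAlgebra.Matrix

/-! ## A nonsingular matrix and its inverse: `σ_min(M) σ_max(M⁻¹) ≥ 1` -/

section InverseBound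

variable {𝕜 : Type*} [RCLike 𝕜] {o : Type*} [Fintype o] [DecidableEq o]

/-- [cite: AllenLaiShen2024, §3 (proof of Thm 3)]
`1 ≤ σ_min(M) · σ_max(M⁻¹)` for a nonsingular `M` (`|o| ≥ 1`; zero-indexed
`σ_min = singularValues (|o| − 1)`, `σ_max = singularValues 0`): from
`‖x‖ = ‖M⁻¹ (M x)‖ ≤ σ_max(M⁻¹) ‖M x‖` and the max–min characterisation of `σ_min(M)` — the
identity `σ₁(L) = 1/σ_{r+1}(ℰ)`, `L = ℰ⁻¹`, of the cited proof (`1 ≤ σ_{r+1}(ℰ) ‖ℰ⁻¹‖₂`). -/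
theorem one_le_singularValues_card_sub_one_mul_singularValues_zero_inv [Nonempty o]
    (M : Matrix o o 𝕜) (hM : IsUnit M.det) :
    1 ≤ (Matrix.toEuclideanLin M).singularValues (Fintype.card o - 1) *
      (Matrix.toEuclideanLin M⁻¹).singularValues 0 := by
  set s := (Matrix.toEuclideanLin M⁻¹).singularValues 0 with hs_def
  have hx : ∀ x, ‖x‖ ≤ s * ‖Matrix.toEuclideanLin M x‖ := fun x => by
    have h := norm_apply_le_singularValues_zero_mul_norm (Matrix.toEuclideanLin M⁻¹)
      (Matrix.toEuclideanLin M x)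
    rwa [← LinearMap.comp_apply, ← Matrix.toLpLin_mul_same, Matrix.nonsing_inv_mul _ hM,
      Matrix.toLpLin_one, LinearMap.id_apply] at h
  have hs : 0 < s := by
    rcases (LinearMap.singularValues_nonneg (Matrix.toEuclideanLin M⁻¹) 0).lt_or_eq with h | h
    · exact h
    · exfalso
      obtain ⟨i⟩ := ‹Nonempty o›
      have h1 := hx (EuclideanSpace.single i (1 : 𝕜))
      rw [← hs_def] at h
      rw [← h, zero_mul, PiLp.norm_single, norm_one] at h1
      exact absurd h1 (by norm_num)
  have hσ := le_singularValues_of_forall_mem_le_norm_apply (Matrix.toEuclideanLin M)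
    finrank_euclideanSpace (Fintype.card o - 1) ⊤
    (by rw [finrank_top, finrank_euclideanSpace]; have := Fintype.card_pos (α := o); omega)
    (c := s⁻¹) fun x _ => by rw [inv_mul_le_iff₀ hs]; exact hx x
  have h := mul_le_mul_of_nonneg_right hσ hs.le
  rwa [inv_mul_cancel₀ hs.ne'] at h

/-- [cite: AllenLaiShen2024, §3 (proof of Thm 3)]
`1 ≤ σ_max(M) · σ_min(M⁻¹)` for a nonsingular `M` (`|o| ≥ 1`) — the identity
`σ_{r+1}(L) = 1/σ₁(ℰ)` of the cited proof; the previous lemma for `M⁻¹`, using `(M⁻¹)⁻¹ = M`. -/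
theorem one_le_singularValues_zero_mul_singularValues_card_sub_one_inv [Nonempty o]
    (M : Matrix o o 𝕜) (hM : IsUnit M.det) :
    1 ≤ (Matrix.toEuclideanLin M).singularValues 0 *
      (Matrix.toEuclideanLin M⁻¹).singularValues (Fintype.card o - 1) := by
  have h := one_le_singularValues_card_sub_one_mul_singularValues_zero_inv M⁻¹
    (Matrix.isUnit_nonsing_inv_det M hM)
  rwa [Matrix.nonsing_inv_nonsing_inv M hM, mul_comm] at h

omit [DecidableEq o] in
/-- [folklore] `Σ_{p,q} |M p q|² ≤ |o|² δ²` when all `|M p q| ≤ δ` (`‖M‖_F ≤ (r+1) ‖M‖_C`). -/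
private theorem sum_sq_norm_entry_le_sq_card_mul_sq (M : Matrix o o 𝕜) {δ : ℝ}
    (h : ∀ p q, ‖M p q‖ ≤ δ) :
    ∑ p, ∑ q, ‖M p q‖ ^ 2 ≤ (Fintype.card o : ℝ) ^ 2 * δ ^ 2 :=
  calc ∑ p, ∑ q, ‖M p q‖ ^ 2 ≤ ∑ _p : o, ∑ _q : o, δ ^ 2 :=
        Finset.sum_le_sum fun p _ => Finset.sum_le_sum fun q _ =>
          pow_le_pow_left₀ (norm_nonneg _) (h p q) 2
    _ = (Fintype.card o : ℝ) ^ 2 * δ ^ 2 := by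
        simp only [Finset.sum_const, Finset.card_univ, nsmul_eq_mul]
        ring

end InverseBound

/-! ## Nonsingular blocks have injective index maps -/

section Injective

variable {K : Type*} [CommRing K] {m n ι : Type*} [Fintype ι] [DecidableEq ι]

/-- [folklore] A nonsingular `A[r, c]` has injective `r` (a repeated row index gives two equal
rows). -/
private theorem injective_rows_of_det_submatrix_ne_zero (A : Matrix m n K) {r : ι → m}
    {c : ι → n} (h : (A.submatrix r c).det ≠ 0) : Function.Injective r := by
  intro p q hpq
  by_contra hne
  exact h (Matrix.det_zero_of_row_eq hne (funext fun s => by simp [Matrix.submatrix_apply, hpq]))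

/-- [folklore] A nonsingular `A[r, c]` has injective `c`. -/
private theorem injective_cols_of_det_submatrix_ne_zero (A : Matrix m n K) {r : ι → m}
    {c : ι → n} (h : (A.submatrix r c).det ≠ 0) : Function.Injective c := by
  intro p q hpq
  by_contra hne
  exact h (Matrix.det_zero_of_column_eq hne fun s => by simp [Matrix.submatrix_apply, hpq])

end Injective

/-! ## Real arithmetic of the proof -/

section Arithmetic

/-- [folklore] The arithmetic of [AllenLaiShen2024, §3 (proof of Thm 3)]: from
`a² + k b² ≤ (k+1)² (ν|γ|)⁻²` (`a = σ₁(L)`, `b = σ_{k+1}(L)`), `1 ≤ τ a`, `1 ≤ τ₀ b`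
(`τ = σ_{k+1}(Â)`, `τ₀ = σ₁(Â)`), `τ ≤ σ`, `τ₀ ≤ σ₀` conclude
`ν² γ² (σ₀² + k σ²) ≤ (k+1)² σ² σ₀²`. -/
private theorem aux_sq_mul_sq_mul_le {a b τ τ₀ σ σ₀ ν γ k : ℝ} (hk : 0 ≤ k) (hν : 0 < ν)
    (hγ : γ ≠ 0) (ha : 0 ≤ a) (hb : 0 ≤ b)
    (h1 : a ^ 2 + k * b ^ 2 ≤ (k + 1) ^ 2 * (ν * |γ|)⁻¹ ^ 2) (h2 : 1 ≤ τ * a)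
    (h3 : 1 ≤ τ₀ * b) (h4 : τ ≤ σ) (h5 : τ₀ ≤ σ₀) :
    ν ^ 2 * γ ^ 2 * (σ₀ ^ 2 + k * σ ^ 2) ≤ (k + 1) ^ 2 * σ ^ 2 * σ₀ ^ 2 := by
  have h2' : 1 ≤ σ * a := h2.trans (mul_le_mul_of_nonneg_right h4 ha)
  have h3' : 1 ≤ σ₀ * b := h3.trans (mul_le_mul_of_nonneg_right h5 hb)
  have h2'' : 1 ≤ σ ^ 2 * a ^ 2 := by
    have h := pow_le_pow_left₀ zero_le_one h2' 2
    rwa [one_pow, mul_pow] at h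
  have h3'' : 1 ≤ σ₀ ^ 2 * b ^ 2 := by
    have h := pow_le_pow_left₀ zero_le_one h3' 2
    rwa [one_pow, mul_pow] at h
  have hνγ2 : (ν * |γ|)⁻¹ ^ 2 * (ν ^ 2 * γ ^ 2) = 1 := by
    rw [inv_pow, mul_pow, sq_abs, inv_mul_cancel₀]
    exact mul_ne_zero (pow_ne_zero 2 hν.ne') (pow_ne_zero 2 hγ)
  have P1 : (a ^ 2 + k * b ^ 2) * (ν ^ 2 * γ ^ 2) * (σ ^ 2 * σ₀ ^ 2) ≤
      (k + 1) ^ 2 * (σ ^ 2 * σ₀ ^ 2) := by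
    have h := mul_le_mul_of_nonneg_right h1 (by positivity : (0 : ℝ) ≤ ν ^ 2 * γ ^ 2)
    rw [mul_assoc ((k + 1) ^ 2), hνγ2, mul_one] at h
    exact mul_le_mul_of_nonneg_right h (by positivity)
  have P2 : ν ^ 2 * γ ^ 2 * σ₀ ^ 2 ≤ ν ^ 2 * γ ^ 2 * σ₀ ^ 2 * (σ ^ 2 * a ^ 2) :=
    le_mul_of_one_le_right (by positivity) h2''
  have P3 : k * (ν ^ 2 * γ ^ 2) * σ ^ 2 ≤ k * (ν ^ 2 * γ ^ 2) * σ ^ 2 * (σ₀ ^ 2 * b ^ 2) :=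
    le_mul_of_one_le_right (by positivity) h3''
  linarith [P1, P2, P3]

/-- [folklore] Product form to quotient form: `ν² γ² (σ₀² + k σ²) ≤ (k+1)² σ² σ₀²` together with
the Goreinov–Tyrtyshnikov bound `|γ| ≤ ν⁻¹ (k+1) σ` (which covers `σ₀ = 0`) give
`|γ| ≤ ν⁻¹ (k+1) σ / √(1 + k σ²/σ₀²)`. -/
private theorem aux_abs_le_div_sqrt {γ σ σ₀ ν k : ℝ} (hk : 0 ≤ k) (hν : 0 < ν) (hσ : 0 ≤ σ)
    (hmain : ν ^ 2 * γ ^ 2 * (σ₀ ^ 2 + k * σ ^ 2) ≤ (k + 1) ^ 2 * σ ^ 2 * σ₀ ^ 2)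
    (hGT : |γ| ≤ ν⁻¹ * ((k + 1) * σ)) :
    |γ| ≤ ν⁻¹ * ((k + 1) * σ) / √(1 + k * σ ^ 2 / σ₀ ^ 2) := by
  have hD : 0 < 1 + k * σ ^ 2 / σ₀ ^ 2 := by positivity
  rw [le_div_iff₀ (Real.sqrt_pos.mpr hD)]
  have hR : 0 ≤ ν⁻¹ * ((k + 1) * σ) := by positivity
  refine (pow_le_pow_iff_left₀ (by positivity) hR two_ne_zero).mp ?_
  rw [mul_pow, Real.sq_sqrt hD.le, sq_abs]
  rcases eq_or_ne σ₀ 0 with hσ₀ | hσ₀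
  · rw [hσ₀, zero_pow two_ne_zero, div_zero, add_zero, mul_one]
    have h := pow_le_pow_left₀ (abs_nonneg γ) hGT 2
    rwa [sq_abs] at h
  · have hνne : ν ≠ 0 := hν.ne'
    have e1 : γ ^ 2 * (1 + k * σ ^ 2 / σ₀ ^ 2) =
        ν ^ 2 * γ ^ 2 * (σ₀ ^ 2 + k * σ ^ 2) / (ν ^ 2 * σ₀ ^ 2) := by
      field_simp
    have e2 : (ν⁻¹ * ((k + 1) * σ)) ^ 2 = (k + 1) ^ 2 * σ ^ 2 * σ₀ ^ 2 / (ν ^ 2 * σ₀ ^ 2) := by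
      field_simp
    rw [e1, e2]
    exact div_le_div_of_nonneg_right hmain (by positivity)

/-- [folklore] The printed square root of [AllenLaiShen2024, Thm 3] is smaller:
`1 + k σ²/((k+1) σ₀²) ≤ 1 + k σ²/σ₀²`. -/
private theorem aux_le_div_sqrt_thm3 {γ σ σ₀ k : ℝ} (hk : 0 ≤ k) (hσ : 0 ≤ σ)
    (h : |γ| ≤ (1 : ℝ)⁻¹ * ((k + 1) * σ) / √(1 + k * σ ^ 2 / σ₀ ^ 2)) :
    |γ| ≤ (k + 1) * σ / √(1 + k * σ ^ 2 / ((k + 1) * σ₀ ^ 2)) := by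
  rw [inv_one, one_mul] at h
  have hdiv : k * σ ^ 2 / ((k + 1) * σ₀ ^ 2) ≤ k * σ ^ 2 / σ₀ ^ 2 := by
    rcases eq_or_ne σ₀ 0 with h0 | h0
    · simp [h0]
    · have h0' : 0 < σ₀ ^ 2 := by positivity
      exact div_le_div_of_nonneg_left (by positivity) h0'
        (le_mul_of_one_le_left h0'.le (by linarith))
  exact h.trans (div_le_div_of_nonneg_left (by positivity) (Real.sqrt_pos.mpr (by positivity))
    (Real.sqrt_le_sqrt (by linarith)))

/-- [folklore] The printed square root of [AllenLaiShen2024, Thm 4] is smaller (`0 < ν ≤ 1`):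
`1 + k σ² ν²/((k+1) σ₀²) ≤ 1 + k σ²/σ₀²`. -/
private theorem aux_le_div_sqrt_thm4 {γ σ σ₀ ν k : ℝ} (hk : 0 ≤ k) (hν : 0 < ν) (hν₁ : ν ≤ 1)
    (hσ : 0 ≤ σ) (h : |γ| ≤ ν⁻¹ * ((k + 1) * σ) / √(1 + k * σ ^ 2 / σ₀ ^ 2)) :
    |γ| ≤ (k + 1) * σ / (ν * √(1 + k * σ ^ 2 * ν ^ 2 / ((k + 1) * σ₀ ^ 2))) := by
  rw [inv_mul_eq_div, div_div] at h
  have hdiv : k * σ ^ 2 * ν ^ 2 / ((k + 1) * σ₀ ^ 2) ≤ k * σ ^ 2 / σ₀ ^ 2 := by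
    rcases eq_or_ne σ₀ 0 with h0 | h0
    · simp [h0]
    · have h0' : 0 < σ₀ ^ 2 := by positivity
      calc k * σ ^ 2 * ν ^ 2 / ((k + 1) * σ₀ ^ 2) ≤ k * σ ^ 2 * ν ^ 2 / σ₀ ^ 2 :=
            div_le_div_of_nonneg_left (by positivity) h0'
              (le_mul_of_one_le_left h0'.le (by linarith))
        _ ≤ k * σ ^ 2 / σ₀ ^ 2 :=
            div_le_div_of_nonneg_right
              (mul_le_of_le_one_right (by positivity) (pow_le_one₀ hν.le hν₁)) h0'.le
  exact h.trans (div_le_div_of_nonneg_left (by positivity) (by positivity)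
    (mul_le_mul_of_nonneg_left (Real.sqrt_le_sqrt (by linarith)) hν.le))

end Arithmetic

/-! ## The refined maximal-volume bound -/

section MaximalVolume

variable {m n : Type*} [Fintype m] [Fintype n] [DecidableEq n] {k : ℕ}

/-- [cite: AllenLaiShen2024, §3 (proof of Thm 3)]; [cite: AllenLaiShen2024, §2 Thm 4]
THE REFINED BOUND, PRODUCT FORM: if `P = A[r, c]` is a nonsingular `k × k` block with
`ν |det A[r', c']| ≤ |det P|` for every `k × k` submatrix of `A` (`0 < ν`; `ν = 1` is maximal
volume), then every entry `γ = (A − Ã) i j` of the cross-interpolation error satisfies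
`ν² γ² (σ₁(A)² + k σ_{k+1}(A)²) ≤ (k+1)² σ_{k+1}(A)² σ₁(A)²` (zero-indexed: `singularValues 0` and
`singularValues k`).  This is the chain `1 ≤ σ_{r+1}(ℰ)² σ₁(L)²`,
`σ₁(L)² ≤ ‖L‖_F² − r σ_{r+1}(L)² ≤ (r+1)² ‖L‖_C² − r/σ₁(A)²`, `‖L‖_C ≤ (ν |γ|)⁻¹`,
`σ_{r+1}(ℰ) ≤ σ_{r+1}(A)` of the cited proof, without its normalisation step
`Σ_i σ_i(L)² ≤ (r+1) σ₁(L)²`. -/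
theorem sq_mul_sq_sub_crossInterp_mul_le_of_volume_submaximal_fin (A : Matrix m n ℝ)
    (r : Fin k → m) (c : Fin k → n) (hP : IsUnit (A.submatrix r c).det) {ν : ℝ} (hν : 0 < ν)
    (hmax : ∀ (r' : Fin k → m) (c' : Fin k → n),
      ν * |(A.submatrix r' c').det| ≤ |(A.submatrix r c).det|)
    (i : m) (j : n) :
    ν ^ 2 * (A - crossInterp A r c) i j ^ 2 *
        ((Matrix.toEuclideanLin A).singularValues 0 ^ 2 +
          k * (Matrix.toEuclideanLin A).singularValues k ^ 2) ≤
      (k + 1) ^ 2 * (Matrix.toEuclideanLin A).singularValues k ^ 2 *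
        (Matrix.toEuclideanLin A).singularValues 0 ^ 2 := by
  by_cases hγ : (A - crossInterp A r c) i j = 0
  · rw [hγ, zero_pow two_ne_zero, mul_zero, zero_mul]
    positivity
  -- the bordered block `B = Â = A[(i, r), (j, c)]` is nonsingular: `det B = det P · γ`
  have hBdet : (A.submatrix (vecCons i r) (vecCons j c)).det ≠ 0 := by
    rw [det_submatrix_vecCons_vecCons A r c hP i j]; exact mul_ne_zero hP.ne_zero hγ
  have hB : IsUnit (A.submatrix (vecCons i r) (vecCons j c)).det := Ne.isUnit hBdet
  have hνγ : 0 < ν * |(A - crossInterp A r c) i j| := mul_pos hν (abs_pos.mpr hγ)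
  -- `‖B⁻¹‖_C ≤ (ν |γ|)⁻¹`
  have hinv : ∀ p q, ‖(A.submatrix (vecCons i r) (vecCons j c))⁻¹ p q‖ ≤
      (ν * |(A - crossInterp A r c) i j|)⁻¹ := fun p q => by
    rw [Real.norm_eq_abs]
    have key := mul_abs_inv_submatrix_vecCons_vecCons_mul_abs_le_one A r c hP hmax i j p q
    calc |(A.submatrix (vecCons i r) (vecCons j c))⁻¹ p q|
        = ν * |(A.submatrix (vecCons i r) (vecCons j c))⁻¹ p q| * |(A - crossInterp A r c) i j| *
            (ν * |(A - crossInterp A r c) i j|)⁻¹ := by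
          rw [eq_comm, mul_inv_eq_iff_eq_mul₀ hνγ.ne']; ring
      _ ≤ 1 * (ν * |(A - crossInterp A r c) i j|)⁻¹ :=
          mul_le_mul_of_nonneg_right key (inv_nonneg.mpr hνγ.le)
      _ = (ν * |(A - crossInterp A r c) i j|)⁻¹ := one_mul _
  -- (1) Frobenius identity + Chebyshev on `L = B⁻¹`: `σ₁(L)² + k σ_{k+1}(L)² ≤ ‖L‖_F² ≤ (k+1)² δ²`
  have h1 : (Matrix.toEuclideanLin (A.submatrix (vecCons i r) (vecCons j c))⁻¹).singularValues 0 ^ 2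
      + k * (Matrix.toEuclideanLin
          (A.submatrix (vecCons i r) (vecCons j c))⁻¹).singularValues k ^ 2 ≤
      (Fintype.card (Fin (k + 1)) : ℝ) ^ 2 * (ν * |(A - crossInterp A r c) i j|)⁻¹ ^ 2 :=
    (sq_singularValues_zero_add_mul_sq_singularValues_le_sum_sq_norm_entry _ k).trans
      (sum_sq_norm_entry_le_sq_card_mul_sq _ hinv)
  rw [Fintype.card_fin, Nat.cast_succ] at h1
  -- (2) `1 ≤ σ_min(B) σ_max(L)` and `1 ≤ σ_max(B) σ_min(L)`
  have h2 := one_le_singularValues_card_sub_one_mul_singularValues_zero_inv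
    (A.submatrix (vecCons i r) (vecCons j c)) hB
  have h3 := one_le_singularValues_zero_mul_singularValues_card_sub_one_inv
    (A.submatrix (vecCons i r) (vecCons j c)) hB
  rw [Fintype.card_fin, Nat.succ_sub_one] at h2 h3
  -- (3) interlacing (`B` is a genuine submatrix of `A`) and the arithmetic
  exact aux_sq_mul_sq_mul_le (Nat.cast_nonneg k) hν hγ (LinearMap.singularValues_nonneg _ _)
    (LinearMap.singularValues_nonneg _ _) h1 h2 h3
    (singularValues_submatrix_le A (injective_rows_of_det_submatrix_ne_zero A hBdet)
      (injective_cols_of_det_submatrix_ne_zero A hBdet) k)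
    (singularValues_submatrix_le A (injective_rows_of_det_submatrix_ne_zero A hBdet)
      (injective_cols_of_det_submatrix_ne_zero A hBdet) 0)

/-- [cite: AllenLaiShen2024, §2 Thm 4]; [cite: AllenLaiShen2024, §3 (proof of Thm 3)]
THE REFINED BOUND WITH A VOLUME RATIO, QUOTIENT FORM: under the hypotheses of
`sq_mul_sq_sub_crossInterp_mul_le_of_volume_submaximal_fin`,
`|(A − Ã) i j| ≤ ν⁻¹ (k+1) σ_{k+1}(A) / √(1 + k σ_{k+1}(A)² / σ₁(A)²)` for all `i, j` — at least
as strong as the printed [AllenLaiShen2024, Thm 4], whose square root is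
`√(1 + k σ²_{k+1} ν² / ((k+1) σ₁²))` (`abs_sub_crossInterp_le_of_volume_submaximal_fin_allenLaiShen`).
(`σ₁(A) = 0` only for `A = 0`, where both sides vanish; Lean's `x / 0 = 0` keeps the statement
true.) -/
theorem abs_sub_crossInterp_le_div_sqrt_of_volume_submaximal_fin (A : Matrix m n ℝ)
    (r : Fin k → m) (c : Fin k → n) (hP : IsUnit (A.submatrix r c).det) {ν : ℝ} (hν : 0 < ν)
    (hmax : ∀ (r' : Fin k → m) (c' : Fin k → n),
      ν * |(A.submatrix r' c').det| ≤ |(A.submatrix r c).det|)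
    (i : m) (j : n) :
    |(A - crossInterp A r c) i j| ≤
      ν⁻¹ * ((k + 1) * (Matrix.toEuclideanLin A).singularValues k) /
        √(1 + k * (Matrix.toEuclideanLin A).singularValues k ^ 2 /
          (Matrix.toEuclideanLin A).singularValues 0 ^ 2) :=
  aux_abs_le_div_sqrt (Nat.cast_nonneg k) hν (LinearMap.singularValues_nonneg _ _)
    (sq_mul_sq_sub_crossInterp_mul_le_of_volume_submaximal_fin A r c hP hν hmax i j)
    (abs_sub_crossInterp_le_mul_singularValues_of_volume_submaximal_fin A r c hP hν hmax i j)

/-- [cite: AllenLaiShen2024, §2 Thm 3]; [cite: AllenLaiShen2024, §3 (proof of Thm 3)]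
THE REFINED MAXIMAL-VOLUME BOUND, QUOTIENT FORM: if the `k × k` pivot block `P = A[r, c]` is
nonsingular and of maximal volume (`|det A[r', c']| ≤ |det P|` for all `k × k` submatrices), then
`|(A − Ã) i j| ≤ (k+1) σ_{k+1}(A) / √(1 + k σ_{k+1}(A)² / σ₁(A)²)` for all `i, j` — at least as
strong as the printed [AllenLaiShen2024, Thm 3], whose square root is
`√(1 + k σ²_{k+1} / ((k+1) σ₁²))` (`abs_sub_crossInterp_le_of_volume_maximal_fin_allenLaiShen`). -/
theorem abs_sub_crossInterp_le_div_sqrt_of_volume_maximal_fin (A : Matrix m n ℝ)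
    (r : Fin k → m) (c : Fin k → n) (hP : IsUnit (A.submatrix r c).det)
    (hmax : ∀ (r' : Fin k → m) (c' : Fin k → n),
      |(A.submatrix r' c').det| ≤ |(A.submatrix r c).det|)
    (i : m) (j : n) :
    |(A - crossInterp A r c) i j| ≤
      (k + 1) * (Matrix.toEuclideanLin A).singularValues k /
        √(1 + k * (Matrix.toEuclideanLin A).singularValues k ^ 2 /
          (Matrix.toEuclideanLin A).singularValues 0 ^ 2) := by
  have h := abs_sub_crossInterp_le_div_sqrt_of_volume_submaximal_fin A r c hP one_pos
    (fun r' c' => by rw [one_mul]; exact hmax r' c') i j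
  rwa [inv_one, one_mul] at h

/-- [cite: AllenLaiShen2024, §2 Thm 3]
ALLEN–LAI–SHEN, THEOREM 3, as printed: under maximal volume of the nonsingular `k × k` pivot
block, `‖A − A_k‖_C ≤ (k+1) σ_{k+1}(A) / √(1 + k σ²_{k+1}(A) / ((k+1) ‖A‖₂²))`, entrywise,
with `‖A‖₂ = σ₁(A) = singularValues 0` (`Literature.LinearAlgebra.Matrix.singularValues_zero_eq_opNorm`)
and zero-indexed `σ_{k+1}(A) = singularValues k`. -/
theorem abs_sub_crossInterp_le_of_volume_maximal_fin_allenLaiShen (A : Matrix m n ℝ)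
    (r : Fin k → m) (c : Fin k → n) (hP : IsUnit (A.submatrix r c).det)
    (hmax : ∀ (r' : Fin k → m) (c' : Fin k → n),
      |(A.submatrix r' c').det| ≤ |(A.submatrix r c).det|)
    (i : m) (j : n) :
    |(A - crossInterp A r c) i j| ≤
      (k + 1) * (Matrix.toEuclideanLin A).singularValues k /
        √(1 + k * (Matrix.toEuclideanLin A).singularValues k ^ 2 /
          ((k + 1) * (Matrix.toEuclideanLin A).singularValues 0 ^ 2)) :=
  aux_le_div_sqrt_thm3 (Nat.cast_nonneg k) (LinearMap.singularValues_nonneg _ _)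
    (abs_sub_crossInterp_le_div_sqrt_of_volume_submaximal_fin A r c hP one_pos
      (fun r' c' => by rw [one_mul]; exact hmax r' c') i j)

/-- [cite: AllenLaiShen2024, §2 Thm 3]; [cite: GolubVanLoan2013, §2.4.2 Cor 2.4.3]
ALLEN–LAI–SHEN, THEOREM 3, with the operator norm: the same bound with `σ₁(A)` written as
`‖A‖₂`, the operator norm of `x ↦ A x` on Euclidean space. -/
theorem abs_sub_crossInterp_le_of_volume_maximal_fin_allenLaiShen_opNorm (A : Matrix m n ℝ)
    (r : Fin k → m) (c : Fin k → n) (hP : IsUnit (A.submatrix r c).det)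
    (hmax : ∀ (r' : Fin k → m) (c' : Fin k → n),
      |(A.submatrix r' c').det| ≤ |(A.submatrix r c).det|)
    (i : m) (j : n) :
    |(A - crossInterp A r c) i j| ≤
      (k + 1) * (Matrix.toEuclideanLin A).singularValues k /
        √(1 + k * (Matrix.toEuclideanLin A).singularValues k ^ 2 /
          ((k + 1) * ‖LinearMap.toContinuousLinearMap (Matrix.toEuclideanLin A)‖ ^ 2)) := by
  rw [← singularValues_zero_eq_opNorm]
  exact abs_sub_crossInterp_le_of_volume_maximal_fin_allenLaiShen A r c hP hmax i j

/-- [cite: AllenLaiShen2024, §2 Thm 4]; [cite: GoreinovTyrtyshnikov2001, Thm 2.2]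
ALLEN–LAI–SHEN, THEOREM 4, as printed (volume ratio `ν ∈ (0, 1]`): if the nonsingular `k × k`
pivot block `P = A[r, c]` has `ν |det A[r', c']| ≤ |det P|` for all `k × k` submatrices (in the
source `|det A_{I,J}| = ν |det A_♢|` with `A_♢` of maximal volume; the dominance of `A_{I,J}` is
not needed), then
`‖A − A_k‖_C ≤ (k+1) σ_{k+1}(A) / (ν √(1 + k σ²_{k+1}(A) ν² / ((k+1) ‖A‖₂²)))`, entrywise
(`‖A‖₂ = singularValues 0`, `σ_{k+1}(A) = singularValues k`). -/
theorem abs_sub_crossInterp_le_of_volume_submaximal_fin_allenLaiShen (A : Matrix m n ℝ)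
    (r : Fin k → m) (c : Fin k → n) (hP : IsUnit (A.submatrix r c).det) {ν : ℝ} (hν : 0 < ν)
    (hν₁ : ν ≤ 1)
    (hmax : ∀ (r' : Fin k → m) (c' : Fin k → n),
      ν * |(A.submatrix r' c').det| ≤ |(A.submatrix r c).det|)
    (i : m) (j : n) :
    |(A - crossInterp A r c) i j| ≤
      (k + 1) * (Matrix.toEuclideanLin A).singularValues k /
        (ν * √(1 + k * (Matrix.toEuclideanLin A).singularValues k ^ 2 * ν ^ 2 /
          ((k + 1) * (Matrix.toEuclideanLin A).singularValues 0 ^ 2))) :=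
  aux_le_div_sqrt_thm4 (Nat.cast_nonneg k) hν hν₁ (LinearMap.singularValues_nonneg _ _)
    (abs_sub_crossInterp_le_div_sqrt_of_volume_submaximal_fin A r c hP hν hmax i j)

/-- [cite: AllenLaiShen2024, §2 Thm 3]; [cite: GoreinovTyrtyshnikov2001, Thm 2.1]
EXISTENCE FORM: for every `k ≤ rank A` there are `k` rows and `k` columns with nonsingular pivot
block (one of maximal volume, `Literature.LinearAlgebra.Matrix.exists_isUnit_det_forall_abs_det_le`)
whose cross interpolation satisfies the refined bound
`|(A − Ã) i j| ≤ (k+1) σ_{k+1}(A) / √(1 + k σ_{k+1}(A)² / σ₁(A)²)` for all `i, j`. -/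
theorem exists_abs_sub_crossInterp_le_div_sqrt (A : Matrix m n ℝ) (hk : k ≤ A.rank) :
    ∃ (r : Fin k → m) (c : Fin k → n), IsUnit (A.submatrix r c).det ∧
      ∀ i j, |(A - crossInterp A r c) i j| ≤
        (k + 1) * (Matrix.toEuclideanLin A).singularValues k /
          √(1 + k * (Matrix.toEuclideanLin A).singularValues k ^ 2 /
            (Matrix.toEuclideanLin A).singularValues 0 ^ 2) := by
  obtain ⟨r, c, hP, hmax⟩ := exists_isUnit_det_forall_abs_det_le A hk
  exact ⟨r, c, hP, abs_sub_crossInterp_le_div_sqrt_of_volume_maximal_fin A r c hP hmax⟩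

/-- [cite: AllenLaiShen2024, §2 Thm 3]
EXISTENCE FORM OF THE PRINTED THEOREM 3: for every `k ≤ rank A` some choice of `k` rows and
`k` columns with nonsingular pivot block achieves
`‖A − A_k‖_C ≤ (k+1) σ_{k+1}(A) / √(1 + k σ²_{k+1}(A) / ((k+1) ‖A‖₂²))`. -/
theorem exists_abs_sub_crossInterp_le_allenLaiShen (A : Matrix m n ℝ) (hk : k ≤ A.rank) :
    ∃ (r : Fin k → m) (c : Fin k → n), IsUnit (A.submatrix r c).det ∧
      ∀ i j, |(A - crossInterp A r c) i j| ≤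
        (k + 1) * (Matrix.toEuclideanLin A).singularValues k /
          √(1 + k * (Matrix.toEuclideanLin A).singularValues k ^ 2 /
            ((k + 1) * (Matrix.toEuclideanLin A).singularValues 0 ^ 2)) := by
  obtain ⟨r, c, hP, hmax⟩ := exists_isUnit_det_forall_abs_det_le A hk
  exact ⟨r, c, hP, abs_sub_crossInterp_le_of_volume_maximal_fin_allenLaiShen A r c hP hmax⟩

end MaximalVolume

end Literature.LinearAlgebra.Matrix
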